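import Literature.AlgebraicGeometry.Resolution.QuasiExcellentSchemes
import Literature.AlgebraicGeometry.Resolution.CompletedPullbackRegular
import HarnessLib

/-!
# The closure in `X` of the singular locus of an open `V ⊆ X`

Topic: `Literature/AlgebraicGeometry/Resolution`. Point-set bookkeeping for Zariski's gluing of a
strong resolution of an open piece (Piltant 2013, proof of Prop. 5.1, Step 5; Zariski 1944): for
an open `V` of a scheme `X` and the open `W ⊆ V` of regular points of `V`, the closed set
`C := closure (V.ι '' Wᶜ)` of `X` (the closure of `Sing V = V ∖ W`) satisfies

* `Scheme.Opens.ι_preimage_compl_closure_image_compl` — `C ∩ V = V ∖ W`, i.e. the preimage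
  under `V ↪ X` of the open `X ∖ C` is `W` (`V ∖ W` is closed IN `V`, and `V ↪ X` is an open
  embedding);
* `regularLocus_subset_compl_closure_image_compl` — `Reg X ⊆ X ∖ C` as soon as `Reg X` is open
  and `W = Reg V` (stalks of `V` and `X` agree, so `V ∖ W ⊆ Sing X`, which is closed).

Pure topology (`preimage_closure_image_eq_of_isOpenEmbedding`) plus the comparison of stalks
along an open immersion. No definitions are introduced: the open `X ∖ C` is written
`⟨(closure (V.ι '' (W : Set V)ᶜ))ᶜ, isClosed_closure.isOpen_compl⟩`.
-/

noncomputable section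

open CategoryTheory AlgebraicGeometry TopologicalSpace Topology

namespace Literature.AlgebraicGeometry.Resolution

universe u

/-- For an open embedding `f` and a closed subset `A` of its source, the preimage of the closure
of `f '' A` is `A` itself. [folklore] -/
theorem preimage_closure_image_eq_of_isOpenEmbedding {α β : Type*} [TopologicalSpace α]
    [TopologicalSpace β] {f : α → β} (hf : IsOpenEmbedding f) {A : Set α} (hA : IsClosed A) :
    f ⁻¹' closure (f '' A) = A := by
  rw [hf.isOpenMap.preimage_closure_eq_closure_preimage hf.continuous,
    Set.preimage_image_eq _ hf.injective, hA.closure_eq]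

/-- For an open embedding `f` and a closed subset `A` of its source, the closure of `f '' A`
meets the range of `f` exactly in `f '' A`. [folklore] -/
theorem closure_image_inter_range_of_isOpenEmbedding {α β : Type*} [TopologicalSpace α]
    [TopologicalSpace β] {f : α → β} (hf : IsOpenEmbedding f) {A : Set α} (hA : IsClosed A) :
    closure (f '' A) ∩ Set.range f = f '' A := by
  apply Set.Subset.antisymm
  · rintro _ ⟨hx, ⟨a, rfl⟩⟩
    have : a ∈ f ⁻¹' closure (f '' A) := hx
    rw [preimage_closure_image_eq_of_isOpenEmbedding hf hA] at this
    exact ⟨a, this, rfl⟩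
  · exact Set.subset_inter subset_closure (Set.image_subset_range _ _)

variable {X : Scheme.{u}} (V : X.Opens) (W : (V : Scheme.{u}).Opens)

/-- **`closure (V ∖ W) ∩ V = V ∖ W`** for an open `W` of an open `V ⊆ X`: the preimage under
`V ↪ X` of the complement of `closure (V.ι '' Wᶜ)` is `W`. [folklore] -/
theorem Scheme.Opens.ι_preimage_compl_closure_image_compl :
    V.ι ⁻¹ᵁ ⟨(closure (V.ι '' (W : Set V)ᶜ))ᶜ, isClosed_closure.isOpen_compl⟩ = W := by
  ext v
  change V.ι v ∈ (closure (V.ι '' (W : Set V)ᶜ))ᶜ ↔ v ∈ (W : Set V)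
  rw [Set.mem_compl_iff, ← Set.mem_preimage,
    preimage_closure_image_eq_of_isOpenEmbedding V.ι.isOpenEmbedding W.isOpen.isClosed_compl]
  simp

/-- A point `v` of `V` lies outside `closure (V.ι '' Wᶜ)` iff `v ∈ W`. [folklore] -/
theorem Scheme.Opens.ι_not_mem_closure_image_compl_iff (v : V) :
    V.ι v ∉ closure (V.ι '' (W : Set V)ᶜ) ↔ v ∈ W := by
  have h := Scheme.Opens.ι_preimage_compl_closure_image_compl V W
  rw [SetLike.ext_iff] at h
  exact h v

/-- **`Reg X ⊆ X ∖ closure (Sing V)`**: if the points of `W` are exactly the regular points of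
`V` and `Reg X` is open, every regular point of `X` lies outside the closure of `V.ι '' Wᶜ`
(local rings of `V` and `X` agree along the open immersion `V ↪ X`, so `V.ι '' Wᶜ ⊆ Sing X`,
a closed set). [folklore] -/
theorem regularLocus_subset_compl_closure_image_compl (hReg : IsOpen (Scheme.regularLocus X))
    (hW : (W : Set V) = Scheme.regularLocus V) :
    Scheme.regularLocus X ⊆ (closure (V.ι '' (W : Set V)ᶜ))ᶜ := by
  have hsub : V.ι '' (W : Set V)ᶜ ⊆ (Scheme.regularLocus X)ᶜ := by
    rintro _ ⟨v, hv, rfl⟩ hv'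
    apply hv
    rw [hW, Scheme.mem_regularLocus]
    rw [Scheme.mem_regularLocus] at hv'
    exact (isRegularLocalRing_stalk_iff_of_isOpenImmersion V.ι v).mp hv'
  have hcl : closure (V.ι '' (W : Set V)ᶜ) ⊆ (Scheme.regularLocus X)ᶜ :=
    closure_minimal hsub hReg.isClosed_compl
  exact Set.subset_compl_comm.mp hcl

end Literature.AlgebraicGeometry.Resolution

end
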